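import Summits.HodgeConjecture.CorCM.HypD3.A4LiuD3LineRigidityOfF8
import Literature.NumberTheory.GelbartRogawski1991.LocalLineIsometryNaturalityHolds
import HarnessLib

/-!
# `hD3` line `a4-liuD3`: THE LAST KERNEL RESIDUAL `LineRigidityS6a` (a4_liuD3 v4 :153/:172) — PROVED, hypothesis-free
# (cell `hodgecm-mathlib`, binder `HypD3`; crux item stmt-HodgeConjecture-24837; director g2 04:41:17Z (a) / 04:44:13Z)

With B-p13's S6a chain complete and hypothesis-free at every finite place
(`LocalSplitting.lineTransportSplitting_lineTransportSection_congrW_undoubledSplittings_holds`, `LocalLineIsometryNaturalityHolds.lean`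
p606519: F6 `LocalKudlaSplittingRigidity` · F7/F7b `LocalScaleModelTransport(Undoubling)` · F8b `LocalLineIsometryRigidity` /
`LocalSplittingCMScaleTransport` / `LocalLineIsometryNaturality` · B-p02's F8a `LocalLineIsometryUndoubling` · B-p18's split-place `hκ`),
the per-character line-rigidity identity holds for every CM field, real frame, splitting character, pair of lines, finite place and
discriminant-relating unit.  This file instantiates it at the family of record (`N := 3`, `L := F`, `χ := toHeckeCharacter (ψ i)`,
`a₁ := aOf i`, `a₂ := aOf j`; `chiLocalSplittingsD` unfolds to its `congrW (undoubledSplittings (cmFinLocalFamily …))` body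
definitionally) through the glue of `A4LiuD3LineRigidityOfF8.lean`:

* `lineRigidityS6a` — the skeleton's place-free residual `Summit.HodgeConjecture.CorCM.Lines.A4LiuD3.LineRigidityS6a`
  (`Cruxes/HD3/Lines/a4_liuD3.lean` v4 e377a69253291a18, :153) stated as its ∀-closure text: slot
  `stub_lineRigidityS6a := HypD3.lineRigidityS6a` (:172);
* `kudlaTransportedSectionEq` — Kudla's transported injectivity `hK i j` for all members at all places (the v2/v3 residual text),
  hypothesis-free.

With these, `hD3` = [Liu2021, Lem. D.1 (3)] AS PRINTED rests on EXACTLY the two named facts IV-4(c1) `rankOne_theta_lines_disjoint`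
and IV-4(c3) `rankOne_theta_twist_rigidity` (B-p19's `hD3_of_lineRigidityS6a`, `HCCMUnconditionalHD3OfFacts.lean`).

HC_CM is proved only modulo the 7 printed citations (`hDel`, `h21`, `hLiu418`, `h411`, `h413`, `hD3`, `hD1''`) until rung 0 closes;
this file discharges no binder and no interface fact (it removes the last non-fact stub of `hD3`'s line).

## References
* [Kudla1994] S. Kudla, Israel J. Math. 87 (1994), §3 Thm. 3.1.
* [GelbartRogawski1991] S. Gelbart, J. Rogawski, Invent. Math. 105 (1991), §3.1 Prop. 3.1.1, Remark p. 457.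
* [Liu2021] Y. Liu, Camb. J. Math. 9 (2021) = arXiv:2102.11518, App. D Lemma D.1 (3) (l. 5233), proof l. 5249–5255.
* [MoeglinVignerasWaldspurger1987] MVW, LNM 1291, Chap. 2 II.1, Chap. 3 I.1–I.3, IV.4.
-/

set_option autoImplicit false

noncomputable section

namespace Summit.HodgeConjecture.CorCM.HypD3
open scoped TensorProduct Matrix
open NumberField NumberField.InfinitePlace
open Literature.NumberTheory.ComplexMultiplication
open Literature.NumberTheory.Automorphic
open Literature.NumberTheory.Automorphic.IdeleClassGroup (toHeckeCharacter isUnitary_toHeckeCharacter)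
open Literature.NumberTheory.Automorphic.Liu2021
open HodgeCM.Model.ArchSideTerm (e₁)
open Literature.NumberTheory.GelbartRogawski1991 Literature.NumberTheory.GelbartRogawski1991.UnitaryDualPair
open Literature.NumberTheory.GelbartRogawski1991.UnitaryDualPair.LocalSplitting (localMu norm_localMu continuous_localMu
  localMu_toLocalRing_eq_one_iff lineTransportSection conj_lineDelta lineDelta_ne_zero lineDelta_mul_self)
open Literature.RepresentationTheory Literature.RepresentationTheory.Liu2021
open Literature.RepresentationTheory.MoeglinVignerasWaldspurger1987 (lineTransportSplitting)
open Summit.HodgeConjecture.CorCM.Transposition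
open Literature.NumberTheory.Weil1964
open Literature.RepresentationTheory.HarrisKudlaSweet1996 Literature.NumberTheory.GaloisRepresentations

open Literature.NumberTheory.GelbartRogawski1991.GRConstruction (localMu_eq_of_congrW_undoubledSplittings_s_eq_three)
open Literature.NumberTheory.GelbartRogawski1991.UnitaryDualPair.LocalSplitting (lineTransportSection_injective)

open Literature.NumberTheory.GelbartRogawski1991.UnitaryDualPair.LocalSplitting
  (lineTransportSplitting_lineTransportSection_congrW_undoubledSplittings_holds)

-- heartbeats: the spelled `hS6a`/`hK` statements alone exceed the default budget (as in the sibling HypD3 files).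
set_option maxHeartbeats 1600000 in
/-- **`LineRigidityS6a` — the place-free line-rigidity residual of `a4_liuD3` v4, PROVED**: for every CM field `F`, real frame
`dV`, index maps `ψ, hψ, aOf`, finite place `v`, members `i, j` and unit `x` with `a_j⁻¹δ = x x̄ a_i⁻¹δ`, B-typ01's line transport by
`x` of member `i`'s model-transported `χ`-splitting of record on the line `a_i` IS member `i`'s model-transported `χ`-splitting of
record on the line `a_j`.  `:= lineRigidityTransported_of_perCharacter (B-p13's hypothesis-free S6a at N = 3)`.
[cite: Kudla1994, §3 Thm. 3.1] [cite: Liu2021, App. D Lemma D.1 (3) (l. 5233), proof l. 5255]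
[cite: MoeglinVignerasWaldspurger1987, Chap. 3 I.1–I.3] -/
theorem lineRigidityS6a :
    ∀ (F : HodgeCM.CMField) (dV : Fin 3 → (F : Type))
      (hdV : ∀ i, IsCMField.complexConj (F : Type) (dV i) = dV i) (hdV0 : ∀ i, dV i ≠ 0) {ι : Type}
      (ψ : ι → (Literature.NumberTheory.Automorphic.IdeleClassGroup (F : Type) →ₜ* Circle))
      (hψ : ∀ t, IdeleClassGroup.IsConjugateSymplectic (F : Type) (ψ t))
      (aOf : ι → (↥(maximalRealSubfield (F : Type)))ˣ)
      (v : IsDedekindDomain.HeightOneSpectrum (𝓞 ↥(maximalRealSubfield (F : Type)))),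
      ∀ i j : ι,
        (∀ (x : (UnitaryGroup.LocalRing (F : Type) v)ˣ) (hx : algebraMap (F : Type) (UnitaryGroup.LocalRing (F : Type) v) (algebraMap ↥(maximalRealSubfield (F : Type)) (F : Type) (↑(aOf j)⁻¹ : ↥(maximalRealSubfield (F : Type))) * imagUnit (F : Type)) =
            (x : (UnitaryGroup.LocalRing (F : Type) v)) * UnitaryGroup.conjLocal (F : Type) (IsCMField.complexConj (F : Type)) v x * algebraMap (F : Type) (UnitaryGroup.LocalRing (F : Type) v) (algebraMap ↥(maximalRealSubfield (F : Type)) (F : Type) (↑(aOf i)⁻¹ : ↥(maximalRealSubfield (F : Type))) * imagUnit (F : Type))),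
          lineTransportSplitting (F : Type) v (IsCMField.complexConj (F : Type)) 3 (conj_lineDelta (complexConj_imagUnit (F : Type)) (aOf i)) (lineDelta_ne_zero (imagUnit_ne_zero (F : Type)) (aOf i))
            (lineDelta_mul_self (imagUnit_mul_self (F : Type)) (aOf i)) (conj_lineDelta (complexConj_imagUnit (F : Type)) (aOf j)) (lineDelta_ne_zero (imagUnit_ne_zero (F : Type)) (aOf j))
            (lineDelta_mul_self (imagUnit_mul_self (F : Type)) (aOf j)) x (realDiagonal (F : Type) dV hdV) (realDiagonal_isSymm (F : Type) dV hdV) (isUnit_det_realDiagonal (F : Type) dV hdV hdV0) hx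
            (lineTransportSection ↥(maximalRealSubfield (F : Type)) (F : Type) (IsCMField.complexConj (F : Type)) 3 (complexConj_imagUnit (F : Type)) (imagUnit_ne_zero (F : Type)) (imagUnit_mul_self (F : Type)) (realDiagonal (F : Type) dV hdV) (realDiagonal_isSymm (F : Type) dV hdV) (Matrix.diagonal dV) (realDiagonal_map (F : Type) dV hdV).symm (aOf i) v ((OmegaChiSplitting.chiLocalSplittingsD ⟨HodgeCM.CMField.K F⟩ e₁ dV hdV hdV0 (toHeckeCharacter (F : Type) (ψ i)) ((isOscillatorChar_toHeckeCharacter_iff (ψ i)).mpr (hψ i)) (aOf i)).s v) ((OmegaChiSplitting.chiLocalSplittingsD ⟨HodgeCM.CMField.K F⟩ e₁ dV hdV hdV0 (toHeckeCharacter (F : Type) (ψ i)) ((isOscillatorChar_toHeckeCharacter_iff (ψ i)).mpr (hψ i)) (aOf i)).proj_s v)) =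
          (lineTransportSection ↥(maximalRealSubfield (F : Type)) (F : Type) (IsCMField.complexConj (F : Type)) 3 (complexConj_imagUnit (F : Type)) (imagUnit_ne_zero (F : Type)) (imagUnit_mul_self (F : Type)) (realDiagonal (F : Type) dV hdV) (realDiagonal_isSymm (F : Type) dV hdV) (Matrix.diagonal dV) (realDiagonal_map (F : Type) dV hdV).symm (aOf j) v ((OmegaChiSplitting.chiLocalSplittingsD ⟨HodgeCM.CMField.K F⟩ e₁ dV hdV hdV0 (toHeckeCharacter (F : Type) (ψ i)) ((isOscillatorChar_toHeckeCharacter_iff (ψ i)).mpr (hψ i)) (aOf j)).s v) ((OmegaChiSplitting.chiLocalSplittingsD ⟨HodgeCM.CMField.K F⟩ e₁ dV hdV hdV0 (toHeckeCharacter (F : Type) (ψ i)) ((isOscillatorChar_toHeckeCharacter_iff (ψ i)).mpr (hψ i)) (aOf j)).proj_s v))) :=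
  lineRigidityTransported_of_perCharacter fun F dV hdV hdV0 μ hμ a₁ a₂ v x hx =>
    lineTransportSplitting_lineTransportSection_congrW_undoubledSplittings_holds (F : Type) dV hdV hdV0 v
      (by norm_num : 0 < 3) μ hμ a₁ a₂ x hx

set_option maxHeartbeats 1600000 in
/-- **`KudlaTransportedSectionEq` — Kudla's local injectivity in transported form for ALL members at ALL finite places,
hypothesis-free** (the v2/v3 residual text of `a4_liuD3`; = `∀ …, hK i j` of `muOfIsoNonsplit_of_facts` / `splitInjective_of_facts`):
`:= kudlaTransportedSectionEq_of_perCharacter (B-p13's hypothesis-free S6a at N = 3)`.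
[cite: Kudla1994, §3 Thm. 3.1] [cite: Liu2021, App. D Lemma D.1 (3) (l. 5233), proof l. 5249–5255] -/
theorem kudlaTransportedSectionEq :
    ∀ (F : HodgeCM.CMField) (dV : Fin 3 → (F : Type))
      (hdV : ∀ i, IsCMField.complexConj (F : Type) (dV i) = dV i) (hdV0 : ∀ i, dV i ≠ 0) {ι : Type}
      (ψ : ι → (Literature.NumberTheory.Automorphic.IdeleClassGroup (F : Type) →ₜ* Circle))
      (hψ : ∀ t, IdeleClassGroup.IsConjugateSymplectic (F : Type) (ψ t))
      (aOf : ι → (↥(maximalRealSubfield (F : Type)))ˣ)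
      (χOf : ι → Def411WeilCarriers.Chi ↥(maximalRealSubfield (F : Type)) (F : Type) (IsCMField.complexConj (F : Type)))
      (v : IsDedekindDomain.HeightOneSpectrum (𝓞 ↥(maximalRealSubfield (F : Type)))),
      ∀ i j : ι,
        (∃ (x : (UnitaryGroup.LocalRing (F : Type) v)ˣ) (hx : algebraMap (F : Type) (UnitaryGroup.LocalRing (F : Type) v) (algebraMap ↥(maximalRealSubfield (F : Type)) (F : Type) (↑(aOf j)⁻¹ : ↥(maximalRealSubfield (F : Type))) * imagUnit (F : Type)) =
            (x : (UnitaryGroup.LocalRing (F : Type) v)) * UnitaryGroup.conjLocal (F : Type) (IsCMField.complexConj (F : Type)) v x * algebraMap (F : Type) (UnitaryGroup.LocalRing (F : Type) v) (algebraMap ↥(maximalRealSubfield (F : Type)) (F : Type) (↑(aOf i)⁻¹ : ↥(maximalRealSubfield (F : Type))) * imagUnit (F : Type))),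
          lineTransportSplitting (F : Type) v (IsCMField.complexConj (F : Type)) 3 (conj_lineDelta (complexConj_imagUnit (F : Type)) (aOf i)) (lineDelta_ne_zero (imagUnit_ne_zero (F : Type)) (aOf i))
            (lineDelta_mul_self (imagUnit_mul_self (F : Type)) (aOf i)) (conj_lineDelta (complexConj_imagUnit (F : Type)) (aOf j)) (lineDelta_ne_zero (imagUnit_ne_zero (F : Type)) (aOf j))
            (lineDelta_mul_self (imagUnit_mul_self (F : Type)) (aOf j)) x (realDiagonal (F : Type) dV hdV) (realDiagonal_isSymm (F : Type) dV hdV) (isUnit_det_realDiagonal (F : Type) dV hdV hdV0) hx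
            (lineTransportSection ↥(maximalRealSubfield (F : Type)) (F : Type) (IsCMField.complexConj (F : Type)) 3 (complexConj_imagUnit (F : Type)) (imagUnit_ne_zero (F : Type)) (imagUnit_mul_self (F : Type)) (realDiagonal (F : Type) dV hdV) (realDiagonal_isSymm (F : Type) dV hdV) (Matrix.diagonal dV) (realDiagonal_map (F : Type) dV hdV).symm (aOf i) v ((OmegaChiSplitting.chiLocalSplittingsD ⟨HodgeCM.CMField.K F⟩ e₁ dV hdV hdV0 (toHeckeCharacter (F : Type) (ψ i)) ((isOscillatorChar_toHeckeCharacter_iff (ψ i)).mpr (hψ i)) (aOf i)).s v) ((OmegaChiSplitting.chiLocalSplittingsD ⟨HodgeCM.CMField.K F⟩ e₁ dV hdV hdV0 (toHeckeCharacter (F : Type) (ψ i)) ((isOscillatorChar_toHeckeCharacter_iff (ψ i)).mpr (hψ i)) (aOf i)).proj_s v)) =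
          (lineTransportSection ↥(maximalRealSubfield (F : Type)) (F : Type) (IsCMField.complexConj (F : Type)) 3 (complexConj_imagUnit (F : Type)) (imagUnit_ne_zero (F : Type)) (imagUnit_mul_self (F : Type)) (realDiagonal (F : Type) dV hdV) (realDiagonal_isSymm (F : Type) dV hdV) (Matrix.diagonal dV) (realDiagonal_map (F : Type) dV hdV).symm (aOf j) v ((OmegaChiSplitting.chiLocalSplittingsD ⟨HodgeCM.CMField.K F⟩ e₁ dV hdV hdV0 (toHeckeCharacter (F : Type) (ψ j)) ((isOscillatorChar_toHeckeCharacter_iff (ψ j)).mpr (hψ j)) (aOf j)).s v) ((OmegaChiSplitting.chiLocalSplittingsD ⟨HodgeCM.CMField.K F⟩ e₁ dV hdV hdV0 (toHeckeCharacter (F : Type) (ψ j)) ((isOscillatorChar_toHeckeCharacter_iff (ψ j)).mpr (hψ j)) (aOf j)).proj_s v))) →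
        localMu (F : Type) (toHeckeCharacter (F : Type) (ψ j)) v = localMu (F : Type) (toHeckeCharacter (F : Type) (ψ i)) v :=
  kudlaTransportedSectionEq_of_perCharacter fun F dV hdV hdV0 μ hμ a₁ a₂ v x hx =>
    lineTransportSplitting_lineTransportSection_congrW_undoubledSplittings_holds (F : Type) dV hdV hdV0 v
      (by norm_num : 0 < 3) μ hμ a₁ a₂ x hx

end Summit.HodgeConjecture.CorCM.HypD3

end
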